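import Mathlib
import HarnessLib
import Summits.NavierStokesRegularity.NavierStokesRegularity.Theorems.ThreadingFluxCentreJetPoloidalRepresentation
import Summits.NavierStokesRegularity.NavierStokesRegularity.Theorems.UnthreadedDoorNetFluxOneSidedLawCalculus
import Summits.NavierStokesRegularity.NavierStokesRegularity.Theorems.UnthreadedDoorAntidynamoSingleDegreeRungGradientBranch

/-!
# Route `UnthreadedDoor` / `ThreadingFlux`, crux `PoloidalLiouville` (stmt-NavierStokesRegularity-1222), antidynamo v2 skeleton
# (sha16 `4ebf5683127b`), WALL `stub_scalarLiouville`: THE HEAD LAW — the GLOBAL gradient form of the potential law (E1)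

Support file (seat leafhand-ns-unthreadeddoor-3 g0, cell decomp-ns), `--supports stmt-NavierStokesRegularity-1222 --as helper`;
theorems only.

CONTEXT.  The wall `StubScalarLiouville` carries its dynamics as the CURLED law (E1)
`∇(𝓛T) × (x − x₀) = ∇m × ∇T` (`𝓛T = ∂ₜT + ⟪v,∇T⟫ − ΔT`, `m = ⟪v, x − x₀⟫`, `x ≠ x₀`), and the skeleton's intended (2b) attack
integrates it only LEVEL-SET-LOCALLY (plan-only stub `StubLevelSetLocalLaw`: off the critical set `{∇T × (x − x₀) = 0}`,
`m = M(T, r, t)` and `𝓛T = −∂_βΦ(T, β, t) + c`, with the explicit CRITICAL-SET CAVEAT that no global `M`/`Φ` exists).  This file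
integrates (E1) GLOBALLY, with no functional-dependence hypothesis and no caveat: the field
`W := (𝓛T)·(x − x₀) − (m + 2)·∇T` has `curl W = ∇(𝓛T) × (x − x₀) − ∇m × ∇T = 0` on the simply connected `ℝ³ ∖ {x₀}`, so it is a
gradient there (the tree's two-chart Poincaré lemma of `ThreadingFluxCentreJetPoloidalRepresentation`).

* `HeadLaw.exists_hasGradientAt_of_curl_eq_zero` — Poincaré lemma on the punctured space: a `C¹` curl-free field on `ℝ³ ∖ {x₀}` is
  `∇χ` with `χ ∈ C²(ℝ³ ∖ {x₀})`.
* `HeadLaw.curl_headField` — `curl (L·(x − x₀) − g·∇θ) = ∇L × (x − x₀) − ∇g × ∇θ` off `x₀`.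
* ★ `HeadLaw.exists_head` — for `v` smooth on the open slab, `T` smooth on the punctured slab and (E1) at every `t < 0`: at every
  `t < 0` there is a HEAD `χ(t,·) ∈ C²(ℝ³ ∖ {x₀})` with
        `∇χ = (∂ₜT + ⟪v,∇T⟫ − ΔT)·(x − x₀) − (⟪v, x − x₀⟫ + 2)·∇T`     on `ℝ³ ∖ {x₀}`.            (HEAD LAW)
  (For a classical solution `v = ∇φ + T·(x − x₀)` with pressure `p` one has `χ = Δφ − ∂ₜφ − p − ½|v|²` up to a constant — the
  momentum equation read modulo nothing; here it is recovered from the vorticity form alone, so it holds in the duality class,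
  where no pressure is available.)
* `HeadLaw.curledLaw_of_head` — conversely the head law implies (E1): the two are EQUIVALENT encodings of the wall's dynamics.
* consequences (pointwise algebra of the head law, `y = x − x₀`, `r = ‖y‖`):
  `cross_gradient_head` — `∇χ × y = −(m + 2)·(∇T × y)` (= `−(m + 2)·curl v` under the representation, `cross_gradient_head_eq_curl`):
  on every sphere about `x₀` the head is a SECOND first integral of the vortex lines, `⟪y, ∇χ × ∇T⟫ = 0` (`inner_cross_gradient_head`);
  `inner_gradient_head` — the radial component `r²·𝓛T = (m + 2)⟪∇T, y⟫ + ⟪∇χ, y⟫`; and its rearrangement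
  ★ `tangentialTransport_head` — `r²(∂ₜT − ΔT) + (r²⟪v,∇T⟫ − ⟪v,y⟫⟪∇T,y⟫) = 2⟪∇T,y⟫ + ⟪∇χ,y⟫`: THE RADIAL DRIFT CANCELS — the
  potential is transported by the TANGENTIAL velocity only, diffused by `Δ + (2/r)∂_r = r⁻¹Δ(r·) − 2r⁻²` (the radial part of the
  Laplacian of `ℝ⁵`, as in KNSS (5.4) for `ω_θ/ϱ`, but about the CENTRE instead of the axis), and forced by the radial head gradient
  `r⁻¹∂_rχ`, whose tangential gradient is in turn slaved to `T` by `∇_Sχ = −(m + 2)∇_S T`.  In the zonal gauge picture this is the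
  skeleton's `𝓛T = −∂_βΦ + c` with `Φ = −χ`, now valid across the critical set.

HONEST LABEL: calculus (an exact and equivalent reformulation of hypothesis (E1) of the registered wall); nothing here proves
`stub_scalarLiouville`, `PoloidalLiouville` (1222) or bears on Navier–Stokes regularity; no summit statement is proved.
[folklore] [cite: MajdaBertozziCUP2002, §1.1 (vector identities), §1.8 (Bernoulli head); KochNadirashviliSereginSverak2009, (5.4)
(arXiv:0709.3599 p. 9); Spivak1965, Thm. 4-11 (Poincaré lemma)]
-/

noncomputable section

-- the summit and its single sub-problem share the name (CONVENTIONS §1)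
set_option linter.dupNamespace false

open Set Function Filter Topology InnerProductSpace
open scoped RealInnerProductSpace ContDiff

namespace Summit.NavierStokesRegularity.NavierStokesRegularity.Theorems.PoloidalLiouville.Antidynamo

open Literature.Analysis Literature.Analysis.FluidPDE
open Summit.NavierStokesRegularity.NavierStokesRegularity.Theorems.PoloidalLiouville.NetFlux (E3)

namespace HeadLaw

/-! ### §1 Poincaré lemma on the punctured space -/

/-- **Poincaré lemma on `ℝ³ ∖ {x₀}`.**  A `C¹` field `W` on the punctured space with `curl W = 0` there is a gradient there:
`W = ∇χ` on `ℝ³ ∖ {x₀}` with `χ ∈ C²(ℝ³ ∖ {x₀})` (two star-shaped charts — the complements of the two closed half-axes through `x₀` —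
glued across their preconnected overlap; the tree's `CentreJet` chart lemmas). [cite: Spivak1965, Thm. 4-11] -/
theorem exists_hasGradientAt_of_curl_eq_zero {W : E3 → E3} {x₀ : E3}
    (hW : ContDiffOn ℝ 1 W ({x₀}ᶜ : Set E3)) (hcurl : ∀ x, x ≠ x₀ → curl W x = 0) :
    ∃ χ : E3 → ℝ, ContDiffOn ℝ 2 χ ({x₀}ᶜ : Set E3) ∧ ∀ x, x ≠ x₀ → HasGradientAt χ (W x) x := by
  have hopen : IsOpen ({x₀}ᶜ : Set E3) := isOpen_compl_singleton
  set R₁ := {x : E3 | (x - x₀) 0 = 0 ∧ (x - x₀) 1 = 0 ∧ 0 ≤ (1 : ℝ) * (x - x₀) 2} with hR₁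
  set R₂ := {x : E3 | (x - x₀) 0 = 0 ∧ (x - x₀) 1 = 0 ∧ 0 ≤ (-1 : ℝ) * (x - x₀) 2} with hR₂
  have hx₀R₁ : x₀ ∈ R₁ := by simp [hR₁]
  have hx₀R₂ : x₀ ∈ R₂ := by simp [hR₂]
  have hR₁s : R₁ᶜ ⊆ ({x₀}ᶜ : Set E3) := compl_subset_compl.2 (singleton_subset_iff.2 hx₀R₁)
  have hR₂s : R₂ᶜ ⊆ ({x₀}ᶜ : Set E3) := compl_subset_compl.2 (singleton_subset_iff.2 hx₀R₂)
  have ho₁ : IsOpen R₁ᶜ := (CentreJet.isClosed_axisRay x₀ 1).isOpen_compl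
  have ho₂ : IsOpen R₂ᶜ := (CentreJet.isClosed_axisRay x₀ (-1)).isOpen_compl
  have hst₁ : StarConvex ℝ (x₀ - (1 : ℝ) • EuclideanSpace.single (2 : Fin 3) (1 : ℝ)) R₁ᶜ :=
    CentreJet.starConvex_compl_axisRay x₀ one_ne_zero
  have hst₂ : StarConvex ℝ (x₀ - (-1 : ℝ) • EuclideanSpace.single (2 : Fin 3) (1 : ℝ)) R₂ᶜ :=
    CentreJet.starConvex_compl_axisRay x₀ (by norm_num)
  have hu₁ := CentreJet.exists_hasFDerivAt_innerSL_of_curl_eq_zero_of_starConvex ho₁ hst₁ (hW.mono hR₁s)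
    fun z hz => hcurl z (hR₁s hz)
  have hu₂ := CentreJet.exists_hasFDerivAt_innerSL_of_curl_eq_zero_of_starConvex ho₂ hst₂ (hW.mono hR₂s)
    fun z hz => hcurl z (hR₂s hz)
  have hconn : IsPreconnected (R₁ᶜ ∩ R₂ᶜ) := by
    rw [hR₁, hR₂, CentreJet.inter_compl_axisRay_eq x₀]
    exact CentreJet.isPreconnected_compl_axisLine x₀
  obtain ⟨χ, hχ'⟩ :=
    CentreJet.exists_hasFDerivAt_of_union (A := fun z => innerSL ℝ (W z)) ho₁ ho₂ hconn hu₁ hu₂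
  have hχ : ∀ x ∈ ({x₀}ᶜ : Set E3), HasFDerivAt χ (innerSL ℝ (W x)) x := fun x hx =>
    hχ' x (CentreJet.mem_union_compl_axisRay hx)
  refine ⟨χ, CentreJet.contDiffOn_two_of_hasFDerivAt_innerSL hopen hW hχ, fun x hx => ?_⟩
  rw [hasGradientAt_iff_hasFDerivAt]
  exact hχ x hx

/-! ### §2 The curl of the head field -/

/-- **`curl (L·(x − x₀) − g·∇θ)(x) = ∇L(x) × (x − x₀) − ∇g(x) × ∇θ(x)`** for `x ≠ x₀`, `L, g` differentiable at `x` and `θ` smooth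
off `x₀` (`curl (x − x₀) = 0`, `curl ∇θ = 0`). [cite: MajdaBertozziCUP2002, §1.1 (vector identities)] -/
theorem curl_headField {L g θ : E3 → ℝ} {x₀ x : E3} (hx : x ≠ x₀) (hL : DifferentiableAt ℝ L x)
    (hg : DifferentiableAt ℝ g x) (hθ : ContDiffOn ℝ (⊤ : ℕ∞) θ ({x₀}ᶜ : Set E3)) :
    curl (fun z => L z • (z - x₀) - g z • gradient θ z) x =
      cross (gradient L x) (x - x₀) - cross (gradient g x) (gradient θ x) := by
  have hopen : IsOpen ({x₀}ᶜ : Set E3) := isOpen_compl_singleton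
  have hgθ : DifferentiableAt ℝ (fun z => gradient θ z) x :=
    ((NetFlux.contDiffOn_gradient_of_isOpen_compl hopen hθ).differentiableOn (by simp) x hx).differentiableAt
      (hopen.mem_nhds hx)
  have h1 : DifferentiableAt ℝ (fun z : E3 => L z • (z - x₀)) x :=
    hL.smul (differentiableAt_id.sub (differentiableAt_const _))
  have h2 : DifferentiableAt ℝ (fun z : E3 => g z • gradient θ z) x := hg.smul hgθ
  have hθ2 : ContDiffOn ℝ 2 θ ({x₀}ᶜ : Set E3) := hθ.of_le (WithTop.coe_le_coe.mpr le_top)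
  rw [curl_sub h1 h2, CentreJet.curl_smul_sub_const hL,
    show (fun z : E3 => g z • gradient θ z) = fun z => g z • (fun w => gradient θ w) z from rfl, curl_smul hg hgθ,
    show (fun w : E3 => gradient θ w) = gradient θ from rfl, curl_gradient_eq_zero_of_contDiffOn hopen hθ2 hx,
    smul_zero, zero_add, fderiv_eq_innerSL_gradient, curlCLM_smulRight_innerSL]

/-! ### §3 ★ The head law -/

/-- ★ **THE HEAD LAW (global gradient form of (E1)).**  Let `v` be smooth on the open slab `(−∞,0) × ℝ³`, `T` smooth on the punctured
slab `(−∞,0) × (ℝ³ ∖ {x₀})`, and suppose the curled potential law (E1)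
`∇(∂ₜT + ⟪v,∇T⟫ − ΔT) × (x − x₀) = ∇⟪v, x − x₀⟫ × ∇T` holds at every `t < 0`, `x ≠ x₀` (hypothesis of the wall `StubScalarLiouville`,
verbatim).  Then at every `t < 0` there is a head `χ ∈ C²(ℝ³ ∖ {x₀})` with
`∇χ(x) = (∂ₜT + ⟪v,∇T⟫ − ΔT)(t,x)·(x − x₀) − (⟪v(t,x), x − x₀⟫ + 2)·∇T(t,x)` for all `x ≠ x₀`.
No functional-dependence hypothesis, no critical-set caveat. [cite: Spivak1965, Thm. 4-11] -/
theorem exists_head {v : ℝ → E3 → E3} {x₀ : E3} {T : ℝ → E3 → ℝ}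
    (hv : ContDiffOn ℝ (⊤ : ℕ∞) (uncurry v) (Iio 0 ×ˢ (univ : Set E3)))
    (hT : ContDiffOn ℝ (⊤ : ℕ∞) (uncurry T) (Iio 0 ×ˢ ({x₀}ᶜ : Set E3)))
    (hE : ∀ t < 0, ∀ x, x ≠ x₀ →
      cross (gradient (fun z => deriv (fun s => T s z) t + ⟪v t z, gradient (T t) z⟫
          - Laplacian.laplacian (T t) z) x) (x - x₀) =
        cross (gradient (fun z => ⟪v t z, z - x₀⟫) x) (gradient (T t) x))
    {t : ℝ} (ht : t < 0) :
    ∃ χ : E3 → ℝ, ContDiffOn ℝ 2 χ ({x₀}ᶜ : Set E3) ∧ ∀ x, x ≠ x₀ →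
      gradient χ x =
        (deriv (fun s => T s x) t + ⟪v t x, gradient (T t) x⟫ - Laplacian.laplacian (T t) x) • (x - x₀)
          - (⟪v t x, x - x₀⟫ + 2) • gradient (T t) x := by
  have hopen : IsOpen ({x₀}ᶜ : Set E3) := isOpen_compl_singleton
  -- restrict to the window `]t − 1, 0[`
  have ht' : t ∈ Ioo (t - 1) 0 := ⟨by linarith, ht⟩
  have hvw : ContDiffOn ℝ (⊤ : ℕ∞) (uncurry v) (Ioo (t - 1) 0 ×ˢ (univ : Set E3)) :=
    hv.mono (prod_mono Ioo_subset_Iio_self Subset.rfl)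
  have hTw : ContDiffOn ℝ (⊤ : ℕ∞) (uncurry T) (Ioo (t - 1) 0 ×ˢ ({x₀}ᶜ : Set E3)) :=
    hT.mono (prod_mono Ioo_subset_Iio_self Subset.rfl)
  -- the frozen-time operator, the radial momentum, the potential slice
  set L : E3 → ℝ := fun z => deriv (fun s => T s z) t + ⟪v t z, gradient (T t) z⟫ - Laplacian.laplacian (T t) z
    with hL_def
  set g : E3 → ℝ := fun z => ⟪v t z, z - x₀⟫ + 2 with hg_def
  have hL : ContDiffOn ℝ 1 L ({x₀}ᶜ : Set E3) := NetFlux.contDiffOn_windowOperator hvw hTw ht'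
  have hvt : ContDiff ℝ (⊤ : ℕ∞) (v t) := NetFlux.contDiff_slice_of_window hvw ht'
  have hTt : ContDiffOn ℝ (⊤ : ℕ∞) (T t) ({x₀}ᶜ : Set E3) := NetFlux.contDiffOn_slice_compl hTw ht'
  have hm : ContDiff ℝ (⊤ : ℕ∞) (fun z : E3 => ⟪v t z, z - x₀⟫) := hvt.inner ℝ (contDiff_id.sub contDiff_const)
  have hg : ContDiff ℝ (⊤ : ℕ∞) g := hm.add contDiff_const
  have hgT : ContDiffOn ℝ (⊤ : ℕ∞) (fun z => gradient (T t) z) ({x₀}ᶜ : Set E3) :=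
    NetFlux.contDiffOn_gradient_of_isOpen_compl hopen hTt
  -- the head field and its regularity
  set W : E3 → E3 := fun z => L z • (z - x₀) - g z • gradient (T t) z with hW_def
  have hW : ContDiffOn ℝ 1 W ({x₀}ᶜ : Set E3) := by
    have h1 : ContDiffOn ℝ 1 (fun z : E3 => L z • (z - x₀)) ({x₀}ᶜ : Set E3) :=
      hL.smul (contDiffOn_id.sub contDiffOn_const)
    have h2 : ContDiffOn ℝ 1 (fun z : E3 => g z • gradient (T t) z) ({x₀}ᶜ : Set E3) :=
      (hg.contDiffOn.of_le (WithTop.coe_le_coe.mpr le_top)).smul (hgT.of_le (WithTop.coe_le_coe.mpr le_top))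
    exact h1.sub h2
  -- `curl W = 0` off `x₀` by (E1)
  have hcurl : ∀ x, x ≠ x₀ → curl W x = 0 := by
    intro x hx
    have hLx : DifferentiableAt ℝ L x :=
      (hL.differentiableOn one_ne_zero x hx).differentiableAt (hopen.mem_nhds hx)
    have hgx : DifferentiableAt ℝ g x := (hg.differentiable (by simp)) x
    have hgg : gradient g x = gradient (fun z : E3 => ⟪v t z, z - x₀⟫) x := by
      simp only [hg_def, gradient, fderiv_add_const]
    rw [hW_def, curl_headField hx hLx hgx hTt, hgg, hE t ht x hx, sub_self]
  obtain ⟨χ, hχ2, hχ⟩ := exists_hasGradientAt_of_curl_eq_zero hW hcurl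
  exact ⟨χ, hχ2, fun x hx => (hχ x hx).gradient⟩

/-- **The head law in the argument order of the wall** (`StubScalarLiouville`'s smoothness and (E1) hypotheses, verbatim; its class,
boundedness and representation hypotheses are not needed). [cite: Spivak1965, Thm. 4-11] -/
theorem exists_head_of_wall_hypotheses :
    ∀ (v : ℝ → EuclideanSpace ℝ (Fin 3) → EuclideanSpace ℝ (Fin 3)) (x₀ : EuclideanSpace ℝ (Fin 3))
      (T : ℝ → EuclideanSpace ℝ (Fin 3) → ℝ),
      ContDiffOn ℝ (⊤ : ℕ∞) (Function.uncurry v) (Set.Iio 0 ×ˢ Set.univ) →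
      ContDiffOn ℝ (⊤ : ℕ∞) (Function.uncurry T) (Set.Iio 0 ×ˢ ({x₀}ᶜ : Set (EuclideanSpace ℝ (Fin 3)))) →
      (∀ t < 0, ∀ x, x ≠ x₀ →
        Literature.Analysis.FluidPDE.cross
            (gradient (fun z => deriv (fun s => T s z) t + inner ℝ (v t z) (gradient (T t) z)
              - Laplacian.laplacian (T t) z) x) (x - x₀) =
          Literature.Analysis.FluidPDE.cross (gradient (fun z => inner ℝ (v t z) (z - x₀)) x) (gradient (T t) x)) →
      ∀ t < 0, ∃ χ : EuclideanSpace ℝ (Fin 3) → ℝ,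
        ContDiffOn ℝ 2 χ ({x₀}ᶜ : Set (EuclideanSpace ℝ (Fin 3))) ∧ ∀ x, x ≠ x₀ →
          gradient χ x =
            (deriv (fun s => T s x) t + inner ℝ (v t x) (gradient (T t) x) - Laplacian.laplacian (T t) x) • (x - x₀)
              - (inner ℝ (v t x) (x - x₀) + 2) • gradient (T t) x :=
  fun _ _ _ hv hT hE _ ht => exists_head hv hT hE ht

/-! ### §4 The converse: the head law implies (E1) -/

/-- **The head law implies the curled law (E1)** at a point: if `∇χ = L·(x − x₀) − g·∇θ` on `ℝ³ ∖ {x₀}` with `χ, θ` smooth enough off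
`x₀` and `L, g` differentiable at `x ≠ x₀`, then `∇L(x) × (x − x₀) = ∇g(x) × ∇θ(x)` (`curl ∇χ = 0`).  With `exists_head`: the head
law and (E1) are EQUIVALENT encodings of the wall's dynamics. [cite: MajdaBertozziCUP2002, §1.1 (vector identities)] -/
theorem curledLaw_of_head {χ L g θ : E3 → ℝ} {x₀ x : E3} (hx : x ≠ x₀) (hχ : ContDiffOn ℝ 2 χ ({x₀}ᶜ : Set E3))
    (hL : DifferentiableAt ℝ L x) (hg : DifferentiableAt ℝ g x) (hθ : ContDiffOn ℝ (⊤ : ℕ∞) θ ({x₀}ᶜ : Set E3))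
    (hhead : ∀ z, z ≠ x₀ → gradient χ z = L z • (z - x₀) - g z • gradient θ z) :
    cross (gradient L x) (x - x₀) = cross (gradient g x) (gradient θ x) := by
  have hopen : IsOpen ({x₀}ᶜ : Set E3) := isOpen_compl_singleton
  have hev : gradient χ =ᶠ[𝓝 x] fun z => L z • (z - x₀) - g z • gradient θ z := by
    filter_upwards [hopen.mem_nhds hx] with z hz
    exact hhead z hz
  have h0 : curl (gradient χ) x = 0 := curl_gradient_eq_zero_of_contDiffOn hopen hχ hx
  rw [curl_congr_of_eventuallyEq hev, curl_headField hx hL hg hθ] at h0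
  exact sub_eq_zero.1 h0

/-! ### §5 Pointwise consequences of the head law -/

/-- Algebra: `(L·y − μ·a) × y = −μ·(a × y)`. [folklore] -/
theorem cross_headVector (L μ : ℝ) (a y : E3) : cross (L • y - μ • a) y = -(μ • cross a y) := by
  ext i
  fin_cases i <;> simp [cross, crossProduct, mul_sub] <;> ring

/-- Algebra: `⟪L·y − μ·a, y⟫ = L‖y‖² − μ⟪a, y⟫`. [folklore] -/
theorem inner_headVector (L μ : ℝ) (a y : E3) : ⟪L • y - μ • a, y⟫ = L * ‖y‖ ^ 2 - μ * ⟪a, y⟫ := by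
  rw [inner_sub_left, inner_smul_left, inner_smul_left, real_inner_self_eq_norm_sq]
  simp

/-- Algebra: `⟪y, (L·y − μ·a) × a⟫ = 0`. [folklore] -/
theorem inner_cross_headVector (L μ : ℝ) (a y : E3) : ⟪y, cross (L • y - μ • a) a⟫ = 0 := by
  simp [cross, crossProduct, PiLp.inner_apply, Fin.sum_univ_three]
  ring

variable {v : ℝ → E3 → E3} {x₀ : E3} {T : ℝ → E3 → ℝ} {χ : E3 → ℝ} {t : ℝ}

/-- **Tangential part of the head law: `∇χ × (x − x₀) = −(m + 2)·(∇T × (x − x₀))`** — on every sphere about `x₀` the tangential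
gradient of the head is `−(m + 2)` times that of the potential. [folklore] -/
theorem cross_gradient_head
    (hχ : ∀ x, x ≠ x₀ → gradient χ x =
      (deriv (fun s => T s x) t + ⟪v t x, gradient (T t) x⟫ - Laplacian.laplacian (T t) x) • (x - x₀)
        - (⟪v t x, x - x₀⟫ + 2) • gradient (T t) x)
    {x : E3} (hx : x ≠ x₀) :
    cross (gradient χ x) (x - x₀) = -((⟪v t x, x - x₀⟫ + 2) • cross (gradient (T t) x) (x - x₀)) := by
  rw [hχ x hx, cross_headVector]

/-- **Under the representation `curl v = ∇T × (x − x₀)`: `∇χ × (x − x₀) = −(m + 2)·curl v`** — the vorticity of an unthreaded flow is,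
up to the weight `−(m + 2)`, the sphere-curl of its head. [folklore] -/
theorem cross_gradient_head_eq_curl
    (hrep : ∀ x, curl (v t) x = cross (gradient (T t) x) (x - x₀))
    (hχ : ∀ x, x ≠ x₀ → gradient χ x =
      (deriv (fun s => T s x) t + ⟪v t x, gradient (T t) x⟫ - Laplacian.laplacian (T t) x) • (x - x₀)
        - (⟪v t x, x - x₀⟫ + 2) • gradient (T t) x)
    {x : E3} (hx : x ≠ x₀) :
    cross (gradient χ x) (x - x₀) = -((⟪v t x, x - x₀⟫ + 2) • curl (v t) x) := by
  rw [hrep x, cross_gradient_head hχ hx]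

/-- **The head is a second first integral of the vortex lines: `⟪x − x₀, ∇χ × ∇T⟫ = 0`** (on every sphere about `x₀` the tangential
gradients of `χ` and `T` are parallel; compare the loop law `⟪x − x₀, ∇m × ∇T⟫ = 0`, the radial component of (E1)). [folklore] -/
theorem inner_cross_gradient_head
    (hχ : ∀ x, x ≠ x₀ → gradient χ x =
      (deriv (fun s => T s x) t + ⟪v t x, gradient (T t) x⟫ - Laplacian.laplacian (T t) x) • (x - x₀)
        - (⟪v t x, x - x₀⟫ + 2) • gradient (T t) x)
    {x : E3} (hx : x ≠ x₀) :
    ⟪x - x₀, cross (gradient χ x) (gradient (T t) x)⟫ = 0 := by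
  rw [hχ x hx, inner_cross_headVector]

/-- **Radial part of the head law: `r²·(∂ₜT + ⟪v,∇T⟫ − ΔT) = (m + 2)·⟪∇T, x − x₀⟫ + ⟪∇χ, x − x₀⟫`**, `r = ‖x − x₀‖`. [folklore] -/
theorem inner_gradient_head
    (hχ : ∀ x, x ≠ x₀ → gradient χ x =
      (deriv (fun s => T s x) t + ⟪v t x, gradient (T t) x⟫ - Laplacian.laplacian (T t) x) • (x - x₀)
        - (⟪v t x, x - x₀⟫ + 2) • gradient (T t) x)
    {x : E3} (hx : x ≠ x₀) :
    ‖x - x₀‖ ^ 2 * (deriv (fun s => T s x) t + ⟪v t x, gradient (T t) x⟫ - Laplacian.laplacian (T t) x) =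
      (⟪v t x, x - x₀⟫ + 2) * ⟪gradient (T t) x, x - x₀⟫ + ⟪gradient χ x, x - x₀⟫ := by
  rw [hχ x hx, inner_headVector]
  ring

/-- ★ **TANGENTIAL TRANSPORT LAW: the radial drift cancels.**  With `y = x − x₀`, `r = ‖y‖`:
`r²·(∂ₜT − ΔT) + (r²⟪v, ∇T⟫ − ⟪v, y⟫⟪∇T, y⟫) = 2⟪∇T, y⟫ + ⟪∇χ, y⟫` — the bracket is `r²·⟪v_tan, ∇_tan T⟫` (tangential transport only),
`ΔT + (2/r²)⟪∇T, y⟫ = ΔT + (2/r)∂_rT` is the radial part of the five-dimensional Laplacian (KNSS (5.4), here about the centre), and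
the forcing is the radial head gradient. [cite: KochNadirashviliSereginSverak2009, (5.4) (arXiv:0709.3599 p. 9)] -/
theorem tangentialTransport_head
    (hχ : ∀ x, x ≠ x₀ → gradient χ x =
      (deriv (fun s => T s x) t + ⟪v t x, gradient (T t) x⟫ - Laplacian.laplacian (T t) x) • (x - x₀)
        - (⟪v t x, x - x₀⟫ + 2) • gradient (T t) x)
    {x : E3} (hx : x ≠ x₀) :
    ‖x - x₀‖ ^ 2 * (deriv (fun s => T s x) t - Laplacian.laplacian (T t) x)
        + (‖x - x₀‖ ^ 2 * ⟪v t x, gradient (T t) x⟫ - ⟪v t x, x - x₀⟫ * ⟪gradient (T t) x, x - x₀⟫) =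
      2 * ⟪gradient (T t) x, x - x₀⟫ + ⟪gradient χ x, x - x₀⟫ := by
  have h := inner_gradient_head hχ hx
  linear_combination h

end HeadLaw

end Summit.NavierStokesRegularity.NavierStokesRegularity.Theorems.PoloidalLiouville.Antidynamo
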